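import Mathlib
import Summits.NavierStokesRegularity.NavierStokesRegularity.Theorems.EulerZoomLiouvillePowerGaugeEulerLiouvilleDSSCountableNodesMember
import Literature.Analysis.FluidPDE.VorticityCalculus
import HarnessLib.Audit

/-!
# Crux E `PowerGaugeEulerLiouville` (stmt-NavierStokesRegularity-19832): THE COUNTABLE-NODES DSS STRATUM IN THE SKELETON'S POINTWISE FORM
# (width seat ns-cas-k2 g3, lane «DSS thin vortical nodes», tool C part 7)

Route `EulerZoomLiouville` (NavierStokesRegularity), crux E.  Twin of `…DSSFiniteNodesMemberPointwise` with COUNTABLY many permanent nodes per ball: the uniform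
subcriticality constant at the NON-VORTICAL nodes of a ball now comes from compactness of that node set (closed: the vorticity of a classical slice is continuous),
not from finiteness.
* `exists_subcritical_const_of_pointwise_nonvortical'` — pointwise strict subcriticality at the non-vortical permanent nodes of a ball ⇒ one `κ < 1` (no finiteness);
* **`ae_eq_zero_of_gauge_of_dss_of_clock_countableNodes_pointwise`** — crux hypotheses (every `ρ > 0`) + classical + `l`-DSS velocity + tame + pressure clock `θ < 1` +
  `(∀ R > 0, pressure core bounds) ∨ (p-DSS law)` + `∀ R, {permanent nodes, ‖y‖ ≤ R}.Countable` + pointwise strict subcriticality at the non-vortical permanent nodes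
  ⇒ `u = 0` a.e.  SKELETON TEXT: as for the finite form with `.Finite` replaced by `.Countable`.

WHAT THIS IS NOT: not NS regularity, not the crux E — a stratum of hypothetical DSS blow-up members; 19832 is OPEN. [folklore]
-/

noncomputable section

set_option linter.dupNamespace false

open MeasureTheory Set Filter Topology Metric Function
open scoped NNReal ENNReal ContDiff InnerProductSpace RealInnerProductSpace

namespace Summit.NavierStokesRegularity.NavierStokesRegularity.Theorems.PowerGaugeEulerLiouville.DSSNodes

open Literature.Analysis Literature.Analysis.FluidPDE Literature.Analysis.FunctionSpaces
open Summit.NavierStokesRegularity.NavierStokesRegularity.Theorems.PowerGaugeEulerLiouville.SimilarityBernoulli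
open Summit.NavierStokesRegularity.NavierStokesRegularity.Theorems.PowerGaugeEulerLiouville.VorticityBirth
open Summit.NavierStokesRegularity.NavierStokesRegularity.Theorems.PowerGaugeEulerLiouville.MovingSpherePiercing

variable {u : ℝ → EuclideanSpace ℝ (Fin 3) → EuclideanSpace ℝ (Fin 3)} {p : ℝ → EuclideanSpace ℝ (Fin 3) → ℝ} {θ ρ l : ℝ}

/-- **POINTWISE ⇒ UNIFORM AT THE NON-VORTICAL NODES OF A BALL — NO FINITENESS.**  `l`-DSS classical member; at each permanent node of the ball `‖y‖ ≤ R` whose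
self-similar path carries no vorticity the scaled stretching form is `< ‖v‖²` for all `t < 0`, `v ≠ 0`.  Then one constant `κ < 1` serves for all of them (the
non-vortical permanent nodes of the ball form a COMPACT set: the vorticity of a classical slice is continuous). [folklore] -/
theorem exists_subcritical_const_of_pointwise_nonvortical' (hcl : IsClassicalEulerSolutionOn (Iio 0) 0 u p) (hl : 1 < l) (hρ2 : 0 < 2 + ρ)
    (hdss : ∀ τ : ℝ, τ < 0 → ∀ y, u τ y = (l ^ (1 + ρ)) • u ((l ^ (2 + ρ)) * τ) (l • y)) {R : ℝ}
    (hpt : ∀ y : EuclideanSpace ℝ (Fin 3), ‖y‖ ≤ R →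
      (∀ t : ℝ, t < 0 → u t ((-t) ^ (2 + ρ)⁻¹ • y) = (-((2 + ρ)⁻¹ * (-t) ^ ((2 + ρ)⁻¹ - 1))) • y) →
      (∀ t : ℝ, t < 0 → curl (u t) ((-t) ^ (2 + ρ)⁻¹ • y) = 0) →
      ∀ t : ℝ, t < 0 → ∀ v : EuclideanSpace ℝ (Fin 3), v ≠ 0 →
        (-t) * ⟪fderiv ℝ (u t) ((-t) ^ (2 + ρ)⁻¹ • y) v, v⟫ < ‖v‖ ^ 2) :
    ∃ κ : ℝ, κ < 1 ∧ ∀ y : EuclideanSpace ℝ (Fin 3), ‖y‖ ≤ R →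
      (∀ t : ℝ, t < 0 → u t ((-t) ^ (2 + ρ)⁻¹ • y) = (-((2 + ρ)⁻¹ * (-t) ^ ((2 + ρ)⁻¹ - 1))) • y) →
      (∀ t : ℝ, t < 0 → curl (u t) ((-t) ^ (2 + ρ)⁻¹ • y) = 0) →
      ∀ t : ℝ, t < 0 → ∀ v : EuclideanSpace ℝ (Fin 3),
        (-t) * ⟪fderiv ℝ (u t) ((-t) ^ (2 + ρ)⁻¹ • y) v, v⟫ ≤ κ * ‖v‖ ^ 2 := by
  -- adapted from `SimilarityBernoulli.exists_subcritical_const_of_pointwise`: the node set is restricted to non-vortical nodes (a closed condition)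
  set n : ℝ := (2 + ρ)⁻¹ with hn
  set T : ℝ := l ^ (2 + ρ) with hT
  have hT1 : 1 < T := Real.one_lt_rpow hl hρ2
  obtain ⟨PN, hPN⟩ : ∃ PN : Set (EuclideanSpace ℝ (Fin 3)), PN = {y | (‖y‖ ≤ R ∧
    ∀ t : ℝ, t < 0 → u t ((-t) ^ n • y) = (-(n * (-t) ^ (n - 1))) • y) ∧
    ∀ t : ℝ, t < 0 → curl (u t) ((-t) ^ n • y) = 0} := ⟨_, rfl⟩
  have hPNc : IsCompact PN := by
    have hperm_closed : IsClosed {y : EuclideanSpace ℝ (Fin 3) |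
        ∀ t : ℝ, t < 0 → u t ((-t) ^ n • y) = (-(n * (-t) ^ (n - 1))) • y} := by
      have e : {y : EuclideanSpace ℝ (Fin 3) | ∀ t : ℝ, t < 0 → u t ((-t) ^ n • y) = (-(n * (-t) ^ (n - 1))) • y} =
          ⋂ t ∈ Iio (0 : ℝ), {y | u t ((-t) ^ n • y) = (-(n * (-t) ^ (n - 1))) • y} := by
        ext y; simp [mem_iInter]
      rw [e]
      refine isClosed_biInter fun t ht => ?_
      have hu : Continuous (u t) := ((hcl.contDiff_velocity ht).of_le (by norm_cast)).continuous
      exact isClosed_eq (hu.comp (continuous_const_smul ((-t) ^ n))) (continuous_const_smul (-(n * (-t) ^ (n - 1))))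
    have hcurl_closed : IsClosed {y : EuclideanSpace ℝ (Fin 3) | ∀ t : ℝ, t < 0 → curl (u t) ((-t) ^ n • y) = 0} := by
      have e : {y : EuclideanSpace ℝ (Fin 3) | ∀ t : ℝ, t < 0 → curl (u t) ((-t) ^ n • y) = 0} =
          ⋂ t ∈ Iio (0 : ℝ), {y | curl (u t) ((-t) ^ n • y) = 0} := by
        ext y; simp [mem_iInter]
      rw [e]
      refine isClosed_biInter fun t ht => ?_
      have h1 : ContDiff ℝ ((0 : ℕ∞) + 1 : ℕ∞) (u t) := (hcl.contDiff_velocity ht).of_le (by exact_mod_cast le_top)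
      have hcu : Continuous (curl (u t)) := (contDiff_curl h1).continuous
      exact isClosed_eq (hcu.comp (continuous_const_smul ((-t) ^ n))) continuous_const
    have h2 : PN = (closedBall 0 R ∩ {y : EuclideanSpace ℝ (Fin 3) |
        ∀ t : ℝ, t < 0 → u t ((-t) ^ n • y) = (-(n * (-t) ^ (n - 1))) • y}) ∩
        {y : EuclideanSpace ℝ (Fin 3) | ∀ t : ℝ, t < 0 → curl (u t) ((-t) ^ n • y) = 0} := by
      rw [hPN]; ext y; simp [and_assoc]
    rw [h2]
    exact ((isCompact_closedBall _ _).inter_right hperm_closed).inter_right hcurl_closed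
  set S : Set (EuclideanSpace ℝ (Fin 3) × ℝ × EuclideanSpace ℝ (Fin 3)) := PN ×ˢ (Icc (-T) (-1) ×ˢ sphere 0 1) with hS
  have hSc : IsCompact S := hPNc.prod (isCompact_Icc.prod (isCompact_sphere _ _))
  set F : EuclideanSpace ℝ (Fin 3) × ℝ × EuclideanSpace ℝ (Fin 3) → ℝ :=
    fun z => (-z.2.1) * ⟪fderiv ℝ (u z.2.1) ((-z.2.1) ^ n • z.1) z.2.2, z.2.2⟫ with hF
  have hDcont : ContinuousOn (uncurry fun t x => fderiv ℝ (u t) x) (Iio (0:ℝ) ×ˢ univ) :=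
    (hcl.smooth_velocity.fderiv_slice isOpen_Iio.uniqueDiffOn).continuousOn
  have hFc : ContinuousOn F {z | z.2.1 < 0} := by
    intro z hz
    have hz0 : z.2.1 < 0 := hz
    have ht : ContinuousAt (fun w : EuclideanSpace ℝ (Fin 3) × ℝ × EuclideanSpace ℝ (Fin 3) => w.2.1) z :=
      (continuous_fst.comp continuous_snd).continuousAt
    have hv : ContinuousAt (fun w : EuclideanSpace ℝ (Fin 3) × ℝ × EuclideanSpace ℝ (Fin 3) => w.2.2) z :=
      (continuous_snd.comp continuous_snd).continuousAt
    have hy : ContinuousAt (fun w : EuclideanSpace ℝ (Fin 3) × ℝ × EuclideanSpace ℝ (Fin 3) => (-w.2.1) ^ n • w.1) z :=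
      (ht.neg.rpow_const (Or.inl (by simp; linarith))).smul continuous_fst.continuousAt
    have hpt' : ContinuousAt (fun w : EuclideanSpace ℝ (Fin 3) × ℝ × EuclideanSpace ℝ (Fin 3) =>
        ((w.2.1, (-w.2.1) ^ n • w.1) : ℝ × EuclideanSpace ℝ (Fin 3))) z := ht.prodMk hy
    have hA : ContinuousAt (fun w : EuclideanSpace ℝ (Fin 3) × ℝ × EuclideanSpace ℝ (Fin 3) =>
        fderiv ℝ (u w.2.1) ((-w.2.1) ^ n • w.1)) z := by
      have hmem : (z.2.1, (-z.2.1) ^ n • z.1) ∈ Iio (0:ℝ) ×ˢ (univ : Set (EuclideanSpace ℝ (Fin 3))) := ⟨hz0, mem_univ _⟩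
      have h1 := (hDcont _ hmem).continuousAt ((isOpen_Iio.prod isOpen_univ).mem_nhds hmem)
      have h2 : ContinuousAt ((uncurry fun t x => fderiv ℝ (u t) x) ∘
          (fun w : EuclideanSpace ℝ (Fin 3) × ℝ × EuclideanSpace ℝ (Fin 3) =>
            ((w.2.1, (-w.2.1) ^ n • w.1) : ℝ × EuclideanSpace ℝ (Fin 3)))) z := ContinuousAt.comp h1 hpt'
      exact h2
    have hAv : ContinuousAt (fun w : EuclideanSpace ℝ (Fin 3) × ℝ × EuclideanSpace ℝ (Fin 3) =>
        fderiv ℝ (u w.2.1) ((-w.2.1) ^ n • w.1) w.2.2) z :=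
      (isBoundedBilinearMap_apply.continuous.continuousAt).comp (hA.prodMk hv)
    exact (ht.neg.mul (hAv.inner hv)).continuousWithinAt
  have hSsub : S ⊆ {z | z.2.1 < 0} := fun z hz => by
    have := hz.2.1.2; show z.2.1 < 0; linarith
  have hreduce : ∀ y ∈ PN, ∀ t : ℝ, t < 0 → ∀ v : EuclideanSpace ℝ (Fin 3), v ≠ 0 →
      ∃ z ∈ S, (-t) * ⟪fderiv ℝ (u t) ((-t) ^ n • y) v, v⟫ = ‖v‖ ^ 2 * F z := by
    intro y hy t ht v hv
    obtain ⟨m, t', ht', hcase⟩ := exists_fundamental_period hT1 ht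
    have ht'0 : t' < 0 := by linarith [ht'.2]
    set w : EuclideanSpace ℝ (Fin 3) := ‖v‖⁻¹ • v with hw
    have hvpos : 0 < ‖v‖ := norm_pos_iff.2 hv
    have hw1 : ‖w‖ = 1 := by
      rw [hw, norm_smul, Real.norm_eq_abs, abs_of_pos (inv_pos.2 hvpos), inv_mul_cancel₀ hvpos.ne']
    have hvw : v = ‖v‖ • w := by rw [hw, smul_smul, mul_inv_cancel₀ hvpos.ne', one_smul]
    have hhom : ∀ s : ℝ, (-s) * ⟪fderiv ℝ (u s) ((-s) ^ n • y) v, v⟫ =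
        ‖v‖ ^ 2 * ((-s) * ⟪fderiv ℝ (u s) ((-s) ^ n • y) w, w⟫) := by
      intro s
      conv_lhs => rw [hvw]
      rw [map_smul, real_inner_smul_left, real_inner_smul_right]
      ring
    refine ⟨(y, t', w), ⟨hy, ht', mem_sphere_zero_iff_norm.2 hw1⟩, ?_⟩
    rw [hhom t]
    congr 1
    simp only [hF]
    rcases hcase with h | h
    · rw [h, hT]; exact stretchingForm_period hl hρ2 hdss m ht'0 y w
    · rw [h, hT]; exact (stretchingForm_period hl hρ2 hdss m ht y w).symm
  rcases S.eq_empty_or_nonempty with hSe | hSne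
  · refine ⟨0, zero_lt_one, fun y hyR hperm h0 t ht v => ?_⟩
    by_cases hv : v = 0
    · simp [hv]
    · obtain ⟨z, hz, -⟩ := hreduce y (by rw [hPN]; exact ⟨⟨hyR, hperm⟩, h0⟩) t ht v hv
      rw [hSe] at hz; exact absurd hz (notMem_empty z)
  · obtain ⟨z₀, hz₀S, hmax⟩ := hSc.exists_isMaxOn hSne (hFc.mono hSsub)
    obtain ⟨hy₀, ht₀, hw₀⟩ := hz₀S
    rw [hPN] at hy₀
    have hw₀1 : ‖z₀.2.2‖ = 1 := mem_sphere_zero_iff_norm.1 hw₀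
    have hF₀ : F z₀ < 1 := by
      have h := hpt z₀.1 hy₀.1.1 hy₀.1.2 hy₀.2 z₀.2.1 (by linarith [ht₀.2]) z₀.2.2 (by
        rw [← norm_ne_zero_iff, hw₀1]; norm_num)
      rw [hw₀1, one_pow] at h
      exact h
    refine ⟨max (F z₀) 0, max_lt hF₀ zero_lt_one, fun y hyR hperm h0 t ht v => ?_⟩
    by_cases hv : v = 0
    · simp [hv]
    · obtain ⟨z, hz, e⟩ := hreduce y (by rw [hPN]; exact ⟨⟨hyR, hperm⟩, h0⟩) t ht v hv
      rw [e, mul_comm]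
      exact mul_le_mul_of_nonneg_right ((hmax hz).trans (le_max_left _ _)) (sq_nonneg _)

/-- **THE COUNTABLE-NODES DSS STRATUM, SKELETON FORM.**  Crux hypotheses verbatim (every `ρ > 0`) + classical + `u(τ,y) = l^{1+ρ}u(l^{2+ρ}τ, ly)` (`l > 1`) + tame + pressure clock
(`θ < 1`) + pressure data (core bounds on every moving ball OR the `p`-DSS law) + for every ball `‖y‖ ≤ R` COUNTABLY MANY permanent nodes + at every permanent node whose
self-similar path carries no vorticity the POINTWISE strict bound `(−t)⟪∇u(t,(−t)ⁿy*)v,v⟫ < ‖v‖²` (`t < 0`, `v ≠ 0`) ⇒ `u = 0` a.e.  Nothing is asked at vortical permanent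
nodes (`volume_setOf_tendsto_vorticalNode_eq_zero`). [folklore] -/
theorem ae_eq_zero_of_gauge_of_dss_of_clock_countableNodes_pointwise (hρ : 0 < ρ)
    {H : ℝ → EuclideanSpace ℝ (Fin 3) → EuclideanSpace ℝ (Fin 3) →L[ℝ] EuclideanSpace ℝ (Fin 3)} {c₀ : ℝ≥0}
    (hsw : IsSuitableWeakSolutionOn (slab (EuclideanSpace ℝ (Fin 3)) (Iio 0) isOpen_Iio) 0 0 u p)
    (hH : HasWeakSpatialGradientOn (slab (EuclideanSpace ℝ (Fin 3)) (Iio 0) isOpen_Iio) u H)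
    (hgauge : ∀ a : ℝ, 0 < a →
      ENNReal.ofReal (a ^ (2 * ρ)) * cknA a (0 : ℝ × EuclideanSpace ℝ (Fin 3)) u +
          ENNReal.ofReal (a ^ ρ) * cknE a (0 : ℝ × EuclideanSpace ℝ (Fin 3)) H +
        ENNReal.ofReal (a ^ (2 * ρ)) * cknD a (0 : ℝ × EuclideanSpace ℝ (Fin 3)) p ≤ (c₀ : ℝ≥0∞))
    (hcl : IsClassicalEulerSolutionOn (Iio 0) 0 u p) (hl : 1 < l)
    (hdss : ∀ τ : ℝ, τ < 0 → ∀ y, u τ y = (l ^ (1 + ρ)) • u ((l ^ (2 + ρ)) * τ) (l • y))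
    (htame : ∀ s t : ℝ, s < t → t < 0 → ∃ B : ℝ, ∀ τ ∈ Icc s t, ∀ y : EuclideanSpace ℝ (Fin 3),
      ‖u τ y‖ ≤ B ∧ ‖fderiv ℝ (u τ) y‖ ≤ B)
    (hθ : θ < 1)
    (hclock : ∀ s : ℝ, s < 0 → ∀ x : EuclideanSpace ℝ (Fin 3),
      (-s) * timeDerivWithin (Iio 0) p s x - (2 + ρ)⁻¹ * fderiv ℝ (p s) x x - 2 * (1 - (2 + ρ)⁻¹) * p s x ≤
        θ * (1 - 2 * (2 + ρ)⁻¹) * ‖u s x + ((2 + ρ)⁻¹ / (-s)) • x‖ ^ 2)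
    (hP : (∀ R : ℝ, 0 < R → ∃ P₀ G : ℝ, ∀ s : ℝ, s < 0 → ∀ x : EuclideanSpace ℝ (Fin 3), ‖x‖ ≤ R * (-s) ^ (2 + ρ)⁻¹ →
        (-s) ^ (2 - 2 * (2 + ρ)⁻¹) * p s x ≤ P₀ ∧ (-s) ^ (2 - (2 + ρ)⁻¹) * ‖gradient (p s) x‖ ≤ G) ∨
      (∀ τ : ℝ, τ < 0 → ∀ y, p τ y = l ^ (2 + 2 * ρ) * p ((l ^ (2 + ρ)) * τ) (l • y)))
    (hcount : ∀ R : ℝ, {y : EuclideanSpace ℝ (Fin 3) | ‖y‖ ≤ R ∧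
      ∀ t : ℝ, t < 0 → u t ((-t) ^ (2 + ρ)⁻¹ • y) = (-((2 + ρ)⁻¹ * (-t) ^ ((2 + ρ)⁻¹ - 1))) • y}.Countable)
    (hnodes : ∀ y : EuclideanSpace ℝ (Fin 3),
      (∀ t : ℝ, t < 0 → u t ((-t) ^ (2 + ρ)⁻¹ • y) = (-((2 + ρ)⁻¹ * (-t) ^ ((2 + ρ)⁻¹ - 1))) • y) →
      (∀ t : ℝ, t < 0 → curl (u t) ((-t) ^ (2 + ρ)⁻¹ • y) = 0) →
      ∀ t : ℝ, t < 0 → ∀ v : EuclideanSpace ℝ (Fin 3), v ≠ 0 →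
        (-t) * ⟪fderiv ℝ (u t) ((-t) ^ (2 + ρ)⁻¹ • y) v, v⟫ < ‖v‖ ^ 2) :
    uncurry u =ᵐ[volume.restrict (Iio (0 : ℝ) ×ˢ (univ : Set (EuclideanSpace ℝ (Fin 3))))] 0 := by
  have hρ2 : 0 < 2 + ρ := by linarith
  have hl0 : 0 < l := zero_lt_one.trans hl
  have hn0 : 0 < (2 + ρ)⁻¹ := inv_pos.2 hρ2
  -- pressure core bounds from either alternative
  have hcoreP : ∀ R : ℝ, 0 < R → ∃ P₀ G : ℝ, ∀ s : ℝ, s < 0 → ∀ x : EuclideanSpace ℝ (Fin 3), ‖x‖ ≤ R * (-s) ^ (2 + ρ)⁻¹ →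
      (-s) ^ (2 - 2 * (2 + ρ)⁻¹) * p s x ≤ P₀ ∧ (-s) ^ (2 - (2 + ρ)⁻¹) * ‖gradient (p s) x‖ ≤ G := by
    rcases hP with h | hpdss
    · exact h
    · exact fun R _ => exists_pressure_core_bounds_of_dss hcl.smooth_pressure hl hρ2 hpdss R
  obtain ⟨B, hB⟩ := htame (-(l ^ (2 + ρ))) (-1) (by linarith [Real.one_lt_rpow hl hρ2]) (by norm_num)
  have hK := exists_typeI_of_dss_tame hl hρ2 (by linarith) hdss hB
  set K : ℝ := l ^ (2 + ρ) * B with hKdef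
  have hΛc : ContinuousOn (fun s : ℝ => K / (-s)) (Iio 0) :=
    continuousOn_const.div continuousOn_neg fun s hs => by rw [mem_Iio] at hs; linarith
  have hΛ : ∀ s : ℝ, s < 0 → ∀ y, ‖fderiv ℝ (u s) y‖ ≤ K / (-s) := fun s hs y => by
    rw [le_div_iff₀ (by linarith), mul_comm]; exact (hK s hs y).1
  have hlip : ODE.IsUniformlyLipschitzOn u (Iio 0) := isUniformlyLipschitzOn hcl hΛc hΛ
  refine ae_eq_zero_of_gauge_of_piercing_of_confinedNull_allRho (n := (2 + ρ)⁻¹) hρ hsw hH hgauge hcl hΛc hΛ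
    (fun R₀ => ?_) (fun τ₀ hτ₀ R hR => ?_)
  · set R : ℝ := max R₀ (K / (2 + ρ)⁻¹ + 1) with hRdef
    have hbR : K < (2 + ρ)⁻¹ * R := by
      have h1 : K / (2 + ρ)⁻¹ + 1 ≤ R := le_max_right _ _
      have h2 : K / (2 + ρ)⁻¹ < R := by linarith
      rwa [div_lt_iff₀ hn0, mul_comm] at h2
    exact ⟨R, le_max_left _ _, fun σ hσ x hx hfast =>
      absurd hfast (not_le.2 (noFastInflow_of_boundedSpeed hσ hbR (fun y _ => (hK σ hσ y).2) hx))⟩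
  · obtain ⟨P₀, G, hPG⟩ := hcoreP R hR
    obtain ⟨κ, hκ, hnode0⟩ := exists_subcritical_const_of_pointwise_nonvortical' hcl hl hρ2 hdss (R := R)
      fun y _ hperm h0 => hnodes y hperm h0
    set N : Set (EuclideanSpace ℝ (Fin 3)) := {y | ‖y‖ ≤ R ∧
      ∀ t : ℝ, t < 0 → u t ((-t) ^ (2 + ρ)⁻¹ • y) = (-((2 + ρ)⁻¹ * (-t) ^ ((2 + ρ)⁻¹ - 1))) • y} with hNdef
    have hsub : {x : EuclideanSpace ℝ (Fin 3) | curl (u τ₀) x ≠ 0 ∧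
        ∀ σ : ℝ, σ ≤ τ₀ → ‖ODE.evolutionMap u τ₀ σ x‖ < R * (-σ) ^ (2 + ρ)⁻¹} ⊆
        ⋃ ys ∈ N, {x : EuclideanSpace ℝ (Fin 3) | curl (u τ₀) ((-τ₀) ^ (2 + ρ)⁻¹ • ys) ≠ 0 ∧
          Tendsto (fun j : ℕ => (l ^ j)⁻¹ • ODE.evolutionMap u τ₀ ((l ^ (2 + ρ)) ^ j * τ₀) x) atTop
            (𝓝 ((-τ₀) ^ (2 + ρ)⁻¹ • ys))} := by
      intro x hx
      rcases dss_curl_eq_zero_or_tendsto_vorticalNode_countable hcl hρ hl hdss hK hθ hclock hκ (fun s hs y hy => (hPG s hs y hy).1)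
          (fun s hs y hy => (hPG s hs y hy).2) (hcount R) hnode0 hτ₀ (fun s hs => (hx.2 s hs).le) with h0 | ⟨ys, hysR, hysN, hv, ht⟩
      · exact absurd h0 hx.1
      · exact mem_biUnion (show ys ∈ N from ⟨hysR, hysN⟩) ⟨hv, ht⟩
    refine measure_mono_null hsub ((measure_biUnion_null_iff (hcount R)).2 fun ys hys => ?_)
    by_cases hv : curl (u τ₀) ((-τ₀) ^ (2 + ρ)⁻¹ • ys) = 0
    · have : {x : EuclideanSpace ℝ (Fin 3) | curl (u τ₀) ((-τ₀) ^ (2 + ρ)⁻¹ • ys) ≠ 0 ∧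
          Tendsto (fun j : ℕ => (l ^ j)⁻¹ • ODE.evolutionMap u τ₀ ((l ^ (2 + ρ)) ^ j * τ₀) x) atTop
            (𝓝 ((-τ₀) ^ (2 + ρ)⁻¹ • ys))} = ∅ :=
        eq_empty_iff_forall_notMem.2 fun x hx => hx.1 hv
      rw [this, measure_empty]
    · refine measure_mono_null (fun x hx => hx.2) ?_
      exact volume_setOf_tendsto_vorticalNode_eq_zero hcl hlip hl hρ hdss hys.2 hτ₀ hv

end Summit.NavierStokesRegularity.NavierStokesRegularity.Theorems.PowerGaugeEulerLiouville.DSSNodes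

end
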